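import Summits.CriticalPhenomena.PercolationContinuityZ3.Theorems.Transplant.SkelFrmFromBChoiceKit
import Summits.CriticalPhenomena.PercolationContinuityZ3.Theorems.Transplant.SkelFrmFromBChoiceAtQPx
import HarnessLib

/-!
# GEN ROW (WAVE-Us-MANIFEST v1.0 §3/§9, INPUT layer) «SkelFrmFromBChoiceKitPx» — the GENERALISED twin of «SkelFrmFromBChoiceKit» §3 (the four `…_cube_of_atQ`
# accuracy wrappers) under `HasProxies t D` in place of `types = {t}` (hunk class 'h1 ↦ proxy package', option (a))

builds on p205010 (kernel theorem, internal audit signed; external expert review pending) — nothing in this file uses p205010.  Each `…At_cube_of_atQPx` is its U twin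
with `h1 ↦ hP`, the consumer-side data `O.merged.toDataN.proxR hP.prox D` and the width floor of «SkelFrmFromBChoiceAtQPx»; accuracy `1 − a³` for `a ≥ δkit` exactly
as in the U twin (`δI3_le_cube_of_le`).  §1–§2 of the U twin (`clauseK_of_atQ`, `κK_int_of_atQ`, `ℓKit_ge_of_atQ`, `hΛRg_of_atQ`) do not read `h1` and are used from
the U twin as they stand.  Nothing about any open node (U, U_s) is claimed.
[cite: KozmaNitzan2024, §4 pp. 19–21 ((21)–(25))] [this work]
-/

noncomputable section

open scoped Classical

namespace Summit.CriticalPhenomena.PercolationContinuityZ3.Theorems.Transplant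

open MeasureTheory Literature.Probability.Percolation Literature.Probability.LatticeModels SimpleGraph KNCells
open SkelConc (Consts)
open Skelφ (oriφ trφ)
open Skelφ.StepI (DataN DataNS OutNS)

namespace PlanarSkeletonFrmFrom

namespace NegB

open Neg

section AtQPx

variable {κ : Consts} {V : Type} [DecidableEq V] [Countable V] {G : SimpleGraph V} [G.LocallyFinite] {Φ : PlanarSkeletonFrmFrom G} {t : V} {p : unitInterval}
  {hC : Φ.CylSubcritical p} {gv fv : Neg.FSlot} {Pv : PSlot} {Sv : SSlot} {cv : CSlot} {bv : BSlot} {O : OutNS V} {q : unitInterval} {D : ℕ}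

/-- **The long pair's piece-links at every centre under proxies at accuracy `1 − a³`** (`a ≥ δkit`; `D ≤ nL`). [cite: KozmaNitzan2024, §4 pp. 19–21] -/
theorem inputsLAt_cube_of_atQPx (hAt : (choiceAtQ3 κ Φ t p Pv gv fv Sv cv bv hC).AtQNQ O q) (hP : Φ.HasProxies t D) {a : ℝ} (ha : Neg.δkit κ Φ ≤ a) (c : V)
    (hn : D ≤ nL κ Φ t p O.merged (gOf κ Φ t p O gv) (fOf κ Φ t p O fv)) (fam : Fin 2) (τ : ℤˣ) :
    1 - a ^ 3 < (bondPercolation G q).real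
      (Skelφ.StepI.eventNAt G (φL κ Φ t p O.D O.DT.toDataN O.ori (gOf κ Φ t p O gv) (fOf κ Φ t p O fv)) (O.merged.toDataN.proxR hP.prox D) t c
        (ML κ Φ t p O.merged (gOf κ Φ t p O gv), some (nL κ Φ t p O.merged (gOf κ Φ t p O gv) (fOf κ Φ t p O fv), fam, 1, τ))) := by
  have h := inputsLAt_of_atQPx hAt hP c hn fam τ
  have hb := δI3_le_cube_of_le κ Φ ha
  linarith

/-- **The short pair's piece-links at every centre under proxies at accuracy `1 − a³`** (`a ≥ δkit`; `D ≤ nS`). [cite: KozmaNitzan2024, §4 pp. 19–21] -/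
theorem inputsSAt_cube_of_atQPx (hAt : (choiceAtQ3 κ Φ t p Pv gv fv Sv cv bv hC).AtQNQ O q) (hP : Φ.HasProxies t D) {a : ℝ} (ha : Neg.δkit κ Φ ≤ a) (c : V)
    (hn : D ≤ nS O.merged) (fam : Fin 2) (τ : ℤˣ) :
    1 - a ^ 3 < (bondPercolation G q).real
      (Skelφ.StepI.eventNAt G (φS t O.D O.DT.toDataN O.ori (Φ := Φ)) (O.merged.toDataN.proxR hP.prox D) t c (Mu O.merged, some (nS O.merged, fam, 1, τ))) := by
  have h := inputsSAt_of_atQPx hAt hP c hn fam τ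
  have hb := δI3_le_cube_of_le κ Φ ha
  linarith

/-- **Any listed pair's piece-links at every centre under proxies at accuracy `1 − a³`** (`a ≥ δkit`; `D ≤ n`). [cite: KozmaNitzan2024, §4 pp. 19–21] -/
theorem inputsPAt_cube_of_atQPx (hAt : (choiceAtQ3 κ Φ t p Pv gv fv Sv cv bv hC).AtQNQ O q) (hP : Φ.HasProxies t D) {a : ℝ} (ha : Neg.δkit κ Φ ≤ a) (c : V)
    {M n : ℕ} (hMn : (M, n) ∈ SMnP κ Φ t p O.merged (gOf κ Φ t p O gv) (fOf κ Φ t p O fv) Pv) (hn : D ≤ n) (fam : Fin 2) (τ : ℤˣ) :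
    1 - a ^ 3 < (bondPercolation G q).real
      (Skelφ.StepI.eventNAt G (Skelφ.oriφ Φ.φ (O.ori t M n)) (O.merged.toDataN.proxR hP.prox D) t c
        (M, some (n, fam, Skelφ.StepI.sgQ O.qd O.qdT O.ori t M n fam, τ))) := by
  have h := inputsPAt_of_atQPx hAt hP c hMn hn fam τ
  have hb := δI3_le_cube_of_le κ Φ ha
  linarith

/-- **The zone at the proxy of every centre at accuracy `1 − a³`** (`a ≥ δkit`; the consumer's zone family is `Λ ∘ prox`). [this work] -/
theorem zoneAt_cube_of_atQPx (hAt : (choiceAtQ3 κ Φ t p Pv gv fv Sv cv bv hC).AtQNQ O q) (hP : Φ.HasProxies t D) {a : ℝ} (ha : Neg.δkit κ Φ ≤ a) (c : V) :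
    1 - a ^ 3 < (bondPercolation G q).real (UniqZone.zone G (O.merged.Λ (hP.prox c)) O.merged.k (Mu O.merged)) := by
  have h := zoneAt_of_atQPx hAt hP c
  have hb := δI3_le_cube_of_le κ Φ ha
  linarith

end AtQPx

end NegB

end PlanarSkeletonFrmFrom

end Summit.CriticalPhenomena.PercolationContinuityZ3.Theorems.Transplant

end
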